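import Literature.Computability.Cryptography.WordRAMPatternTables
import Literature.Computability.AlgebraicComplexity.KroneckerPowEvaluation
import HarnessLib

/-!
# The word RAM — filling the three input vectors of Pratt's evaluation (relabelled membership × random 4-bit values)

The "fill" step of one repetition of Pratt's balanced-tripartitioning algorithm (K. Pratt, STOC
2024, proof of Thm. 1.9: "Set `X_a = 0` if `a ∉ 𝓕₁'` and let `X_a` be a uniformly random element of
`Y` otherwise, and similarly for the `Y` and `Z` variables"; eleventh instalment of the proof of
`Literature.Computability.AlgebraicComplexity.pratt2024_thm_1_9`), as a verified structured
word-RAM program over flat indices `idx < Ntot = C^r`: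

* the mask of `idx` is `maskSum … idx r = ∑_{u<r} PT[u][digit C u idx]` (the bit mask of the
  relabelled block string named by `idx`; `PT` from `WordRAMPatternTables.tabProd`, `digit` from
  `KroneckerPowEvaluation`), computed by peeling base-`C` digits (`digLoop_spec`);
* for each leg `l < 3` the entry written is `Ftab_l[mask] · (coin mod 16)` — membership bit of the
  mask in the `l`-th (padded, tabulated) family times a fresh 4-bit random value, three coin words
  per index (`fillProg_spec`, `Ntot (8 r + 37) + 6` steps).

Registers: inputs `33 = pt`, `35 = C`, `36 = r`, `38 = Ntot`, `39–41 = FT₀,FT₁,FT₂`,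
`42–44 = X₀,X₁,X₂`, `80` = coin pointer (advanced by `3 Ntot`); temporaries `82–94`.

## References

* K. Pratt, *A stronger connection between the asymptotic rank conjecture and the set cover
  conjecture*, STOC 2024, arXiv:2311.02774, §2 (proof of Thm. 1.9).
* T. Nipkow, G. Klein, *Concrete Semantics with Isabelle/HOL*, Springer 2014, §12.2.
-/

namespace Literature.Computability.Cryptography.WordRAM

open StateTransition Finset Literature.Computability.AlgebraicComplexity

open scoped BigOperators

/-- The low four bits of a word. [folklore] -/
theorem Nat.and_fifteen (x : ℕ) : x &&& 15 = x % 16 := by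
  have h := Nat.and_two_pow_sub_one_eq_mod x 4
  norm_num at h
  exact h

namespace SProg

variable {w : ℕ} {O : List ℕ → List ℕ}

/-! ## The mask of an index: peeling digits -/

/-- The partial mask `∑_{u'<u} PT[u'][digit C u' idx]` (`PT[u][j]` at `pt + u C + j`). [cite: Pratt2024SCC, §2 (proof of Thm. 1.9)] -/
def maskSum (m : ℕ → ℕ) (pt C idx u : ℕ) : ℕ := ∑ u' ∈ range u, m (pt + u' * C + digit C u' idx)

/-- Partial masks are monotone. [folklore] -/
theorem maskSum_mono (m : ℕ → ℕ) (pt C idx : ℕ) {u v : ℕ} (h : u ≤ v) :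
    maskSum m pt C idx u ≤ maskSum m pt C idx v :=
  sum_le_sum_of_subset (range_subset_range.2 h)

/-- One more digit. [folklore] -/
theorem maskSum_succ (m : ℕ → ℕ) (pt C idx u : ℕ) :
    maskSum m pt C idx (u + 1) = maskSum m pt C idx u + m (pt + u * C + digit C u idx) := by
  unfold maskSum; rw [sum_range_succ]

/-- The digit loop: `dg := t mod C; t := t / C; a := ptrow + dg; mask += mem[a]; ptrow += C; cnt -= 1`.
[folklore] -/
def digBody : List OpSpec :=
  [(.mod, .dir 88, .dir 85, .dir 35), (.div, .dir 85, .dir 85, .dir 35),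
    (.add, .dir 88, .dir 86, .dir 88), (.add, .dir 84, .dir 84, .ind 88),
    (.add, .dir 86, .dir 86, .dir 35), (.sub, .dir 87, .dir 87, .imm 1)]

/-- Invariant of the digit loop after `u` digits (reference memory `m₀` = memory at its start). [folklore] -/
structure DGInv (m₀ : ℕ → ℕ) (pt C r idx : ℕ) (qs : List (List ℕ)) (u : ℕ) (st : Store) : Prop where
  queries : st.queries = qs
  r35 : st.mem 35 = C
  r84 : st.mem 84 = maskSum m₀ pt C idx u
  r85 : st.mem 85 = idx / C ^ u
  r86 : st.mem 86 = pt + u * C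
  r87 : st.mem 87 = r - u
  frame : ∀ c, c ≠ 84 → c ≠ 85 → c ≠ 86 → c ≠ 87 → c ≠ 88 → st.mem c = m₀ c

set_option linter.unusedSimpArgs false in
/-- One digit. [folklore] -/
theorem digBody_spec {m₀ : ℕ → ℕ} {pt C r idx : ℕ} {qs : List (List ℕ)} {u : ℕ} (hu : u < r)
    (hpt : 100 ≤ pt) (hC : 1 ≤ C) (hptE : pt + r * C < 2 ^ w)
    (hmask : maskSum m₀ pt C idx r < 2 ^ w) {st : Store} (h : DGInv m₀ pt C r idx qs u st) :
    ∃ st', Exec w O (block digBody) st st' 6 ∧ DGInv m₀ pt C r idx qs (u + 1) st' := by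
  obtain ⟨hq, h35, h84, h85, h86, h87, hfr⟩ := h
  obtain ⟨mm, qq⟩ := st
  simp only at hq h35 h84 h85 h86 h87 hfr
  subst qq
  have hdg : idx / C ^ u % C < C := Nat.mod_lt _ (by omega)
  have hrC : r ≤ r * C := Nat.le_mul_of_pos_right r hC
  have huC : u * C + C ≤ r * C := by
    have := Nat.mul_le_mul_right C hu; rw [Nat.succ_mul] at this; exact this
  have hcell : mm (pt + u * C + idx / C ^ u % C) = m₀ (pt + u * C + idx / C ^ u % C) :=
    hfr _ (by omega) (by omega) (by omega) (by omega) (by omega)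
  have hle : maskSum m₀ pt C idx u + m₀ (pt + u * C + idx / C ^ u % C) ≤ maskSum m₀ pt C idx r := by
    have h1 := maskSum_succ m₀ pt C idx u
    rw [digit_def] at h1
    rw [← h1]; exact maskSum_mono m₀ pt C idx (by omega)
  have hdiv : idx / C ^ u / C = idx / C ^ (u + 1) := by rw [Nat.div_div_eq_div_mul, ← pow_succ]
  refine Exec.block_of_fwd digBody qs fun Rf hR => ?_
  unfold digBody at hR
  have htmp := execOps_cons_fwd hR; clear hR; obtain ⟨v1, hv1, hR⟩ := htmp
  simp -failIfUnchanged (disch := omega) only [Operand.write, Operand.read,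
    Function.update_self, Function.update_of_ne, BinOp.eval_add_mod', BinOp.eval_mul_mod',
    Nat.mod_eq_of_lt, BinOp.eval_sub_of_le, BinOp.eval_mod, BinOp.eval_div, BinOp.eval_band,
    Nat.add_zero, h85, h35] at hv1 hR
  subst v1
  have htmp := execOps_cons_fwd hR; clear hR; obtain ⟨v2, hv2, hR⟩ := htmp
  simp -failIfUnchanged (disch := omega) only [Operand.write, Operand.read,
    Function.update_self, Function.update_of_ne, BinOp.eval_add_mod', BinOp.eval_mul_mod',
    Nat.mod_eq_of_lt, BinOp.eval_sub_of_le, BinOp.eval_mod, BinOp.eval_div, BinOp.eval_band,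
    Nat.add_zero, h85, h35, hdiv] at hv2 hR
  subst v2
  have htmp := execOps_cons_fwd hR; clear hR; obtain ⟨v3, hv3, hR⟩ := htmp
  simp -failIfUnchanged (disch := omega) only [Operand.write, Operand.read,
    Function.update_self, Function.update_of_ne, BinOp.eval_add_mod', BinOp.eval_mul_mod',
    Nat.mod_eq_of_lt, BinOp.eval_sub_of_le, BinOp.eval_mod, BinOp.eval_div, BinOp.eval_band,
    Nat.add_zero, h86] at hv3 hR
  subst v3
  have htmp := execOps_cons_fwd hR; clear hR; obtain ⟨v4, hv4, hR⟩ := htmp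
  simp -failIfUnchanged (disch := omega) only [Operand.write, Operand.read,
    Function.update_self, Function.update_of_ne, BinOp.eval_add_mod', BinOp.eval_mul_mod',
    Nat.mod_eq_of_lt, BinOp.eval_sub_of_le, BinOp.eval_mod, BinOp.eval_div, BinOp.eval_band,
    Nat.add_zero, h84, hcell] at hv4 hR
  subst v4
  have htmp := execOps_cons_fwd hR; clear hR; obtain ⟨v5, hv5, hR⟩ := htmp
  simp -failIfUnchanged (disch := omega) only [Operand.write, Operand.read,
    Function.update_self, Function.update_of_ne, BinOp.eval_add_mod', BinOp.eval_mul_mod',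
    Nat.mod_eq_of_lt, BinOp.eval_sub_of_le, BinOp.eval_mod, BinOp.eval_div, BinOp.eval_band,
    Nat.add_zero, h86, h35] at hv5 hR
  subst v5
  have htmp := execOps_cons_fwd hR; clear hR; obtain ⟨v6, hv6, hR⟩ := htmp
  simp -failIfUnchanged (disch := omega) only [Operand.write, Operand.read,
    Function.update_self, Function.update_of_ne, BinOp.eval_add_mod', BinOp.eval_mul_mod',
    Nat.mod_eq_of_lt, BinOp.eval_sub_of_le, BinOp.eval_mod, BinOp.eval_div, BinOp.eval_band,
    Nat.add_zero, h87] at hv6 hR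
  subst v6
  simp only [execOps_nil] at hR
  subst hR
  refine ⟨rfl, ?_, ?_, ?_, ?_, ?_, fun c h84' h85' h86' h87' h88' => ?_⟩ <;> dsimp only
  · simp (disch := omega) only [Function.update_of_ne, Function.update_self]; exact h35
  · simp (disch := omega) only [Function.update_of_ne, Function.update_self]
    rw [maskSum_succ, digit_def]
  · simp (disch := omega) only [Function.update_of_ne, Function.update_self]
  · simp (disch := omega) only [Function.update_of_ne, Function.update_self]; rw [Nat.succ_mul]; omega
  · simp (disch := omega) only [Function.update_of_ne, Function.update_self]; omega
  · simp (disch := omega) only [Function.update_of_ne, Function.update_self]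
    exact hfr c h84' h85' h86' h87' h88'

/-- The digit loop: the full mask within `8 r + 1` steps. [folklore] -/
theorem digLoop_spec {m₀ : ℕ → ℕ} {pt C r idx : ℕ} {qs : List (List ℕ)}
    (hpt : 100 ≤ pt) (hC : 1 ≤ C) (hptE : pt + r * C < 2 ^ w)
    (hmask : maskSum m₀ pt C idx r < 2 ^ w) {st : Store} (h : DGInv m₀ pt C r idx qs 0 st) :
    ∃ st', ExecLE w O (whilenz (.dir 87) (block digBody)) st st' (r * 8 + 1) ∧
      DGInv m₀ pt C r idx qs r st' :=
  ExecLE.whilenz_invariant (w := w) (O := O) (x := .dir 87) (s := block digBody) r 6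
    (fun u st => DGInv m₀ pt C r idx qs u st)
    (fun u hu st hst => ⟨by rw [Operand.read_dir, hst.r87]; omega,
      by obtain ⟨st', hex, hinv⟩ := digBody_spec (w := w) (O := O) hu hpt hC hptE hmask hst
         exact ⟨st', hex.execLE, hinv⟩⟩)
    (fun st hst => by rw [Operand.read_dir, hst.r87]; omega) h

/-! ## The loop over indices -/

/-- Before the digits: `mask := 0; t := idx; ptrow := pt; cnt := r`. [folklore] -/
def idxPre : List OpSpec :=
  [(.add, .dir 84, .imm 0, .imm 0), (.add, .dir 85, .dir 83, .imm 0),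
    (.add, .dir 86, .dir 33, .imm 0), (.add, .dir 87, .dir 36, .imm 0)]

/-- One leg `l`: `c := coins[cp]; cp += 1; v := c & 15; a := FT_l + mask; f := mem[a]; f := f * v;
mem[xptr_l] := f; xptr_l += 1`. [cite: Pratt2024SCC, §2 (proof of Thm. 1.9)] -/
def legOps (l : ℕ) : List OpSpec :=
  [(.add, .dir 89, .ind 80, .imm 0), (.add, .dir 80, .dir 80, .imm 1),
    (.band, .dir 90, .dir 89, .imm 15), (.add, .dir 88, .dir (39 + l), .dir 84),
    (.add, .dir 91, .ind 88, .imm 0), (.mul, .dir 91, .dir 91, .dir 90),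
    (.add, .ind (92 + l), .dir 91, .imm 0), (.add, .dir (92 + l), .dir (92 + l), .imm 1)]

/-- After the digits: the three legs, then `idx += 1; cnt -= 1`. [folklore] -/
def idxPost : List OpSpec :=
  legOps 0 ++ legOps 1 ++ legOps 2 ++ [(.add, .dir 83, .dir 83, .imm 1), (.sub, .dir 82, .dir 82, .imm 1)]

/-- Set-up: `cnt := Ntot; idx := 0; xptr_l := X_l`. [folklore] -/
def fillSetup : List OpSpec :=
  [(.add, .dir 82, .dir 38, .imm 0), (.add, .dir 83, .imm 0, .imm 0),
    (.add, .dir 92, .dir 42, .imm 0), (.add, .dir 93, .dir 43, .imm 0), (.add, .dir 94, .dir 44, .imm 0)]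

/-- The body of the index loop. [folklore] -/
def idxBody : SProg := seq (block idxPre) (seq (whilenz (.dir 87) (block digBody)) (block idxPost))

/-- **The fill program.** [cite: Pratt2024SCC, §2 (proof of Thm. 1.9)] -/
def fillProg : SProg := seq (block fillSetup) (whilenz (.dir 82) idxBody)

/-- The layout of the fill step: `PT` at `pt` (`r × C`), `Ntot` indices, three membership tables at
`FT l` (each of `MB` cells, entries `≤ 1`, all masks `< MB`), three destinations at `X l`, coins at
`cp₀` (`3 Ntot` words). [folklore] -/
structure FillLayout where
  /-- Base of the pattern-mask table. -/
  pt : ℕ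
  /-- Number of patterns per block. -/
  C : ℕ
  /-- Number of blocks. -/
  r : ℕ
  /-- Number of indices. -/
  Ntot : ℕ
  /-- Bases of the three membership tables. -/
  FT : ℕ → ℕ
  /-- Size of each membership table. -/
  MB : ℕ
  /-- Bases of the three destination vectors. -/
  X : ℕ → ℕ
  /-- Address of the first coin word. -/
  cp₀ : ℕ

/-- The value written at index `i` of leg `l`. [cite: Pratt2024SCC, §2 (proof of Thm. 1.9)] -/
def fillVal (m : ℕ → ℕ) (Lay : FillLayout) (l i : ℕ) : ℕ :=
  m (Lay.FT l + maskSum m Lay.pt Lay.C i Lay.r) * (m (Lay.cp₀ + 3 * i + l) % 16)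

/-- The static side conditions of the fill step. [folklore] -/
structure FillSide (w : ℕ) (m : ℕ → ℕ) (Lay : FillLayout) : Prop where
  hpt : 100 ≤ Lay.pt
  hC : 1 ≤ Lay.C
  hptE : Lay.pt + Lay.r * Lay.C < 2 ^ w
  hNtot : Lay.Ntot < 2 ^ w
  hFT : ∀ l, l < 3 → 100 ≤ Lay.FT l ∧ Lay.FT l + Lay.MB < 2 ^ w
  hX : ∀ l, l < 3 → 100 ≤ Lay.X l ∧ Lay.X l + Lay.Ntot < 2 ^ w
  hcp : 100 ≤ Lay.cp₀
  hcpE : Lay.cp₀ + 3 * Lay.Ntot < 2 ^ w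
  hw : 4 ≤ w
  hX_pt : ∀ l, l < 3 → Lay.X l + Lay.Ntot ≤ Lay.pt ∨ Lay.pt + Lay.r * Lay.C ≤ Lay.X l
  hX_FT : ∀ l l', l < 3 → l' < 3 → Lay.X l + Lay.Ntot ≤ Lay.FT l' ∨ Lay.FT l' + Lay.MB ≤ Lay.X l
  hX_cp : ∀ l, l < 3 → Lay.X l + Lay.Ntot ≤ Lay.cp₀ ∨ Lay.cp₀ + 3 * Lay.Ntot ≤ Lay.X l
  hX_X : ∀ l l', l < 3 → l' < 3 → l ≠ l' → Lay.X l + Lay.Ntot ≤ Lay.X l' ∨ Lay.X l' + Lay.Ntot ≤ Lay.X l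
  hmask : ∀ i, i < Lay.Ntot → maskSum m Lay.pt Lay.C i Lay.r < Lay.MB
  hbit : ∀ l a, l < 3 → a < Lay.MB → m (Lay.FT l + a) ≤ 1
  hcoin : ∀ t, t < 3 * Lay.Ntot → m (Lay.cp₀ + t) < 2 ^ w

/-- Invariant of the index loop after `i` indices. [folklore] -/
structure IdxInv (m : ℕ → ℕ) (Lay : FillLayout) (qs : List (List ℕ)) (i : ℕ) (st : Store) : Prop where
  queries : st.queries = qs
  r33 : st.mem 33 = Lay.pt
  r35 : st.mem 35 = Lay.C
  r36 : st.mem 36 = Lay.r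
  r38 : st.mem 38 = Lay.Ntot
  r39 : st.mem 39 = Lay.FT 0
  r40 : st.mem 40 = Lay.FT 1
  r41 : st.mem 41 = Lay.FT 2
  r80 : st.mem 80 = Lay.cp₀ + 3 * i
  r82 : st.mem 82 = Lay.Ntot - i
  r83 : st.mem 83 = i
  r92 : st.mem 92 = Lay.X 0 + i
  r93 : st.mem 93 = Lay.X 1 + i
  r94 : st.mem 94 = Lay.X 2 + i
  written : ∀ l i', l < 3 → i' < i → st.mem (Lay.X l + i') = fillVal m Lay l i'
  frame : ∀ c, c ≠ 80 → ¬ (82 ≤ c ∧ c ≤ 94) → ¬ (Lay.X 0 ≤ c ∧ c < Lay.X 0 + i) →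
    ¬ (Lay.X 1 ≤ c ∧ c < Lay.X 1 + i) → ¬ (Lay.X 2 ≤ c ∧ c < Lay.X 2 + i) → st.mem c = m c

set_option linter.unusedSimpArgs false in
/-- `idxPre` sets up the digit loop of index `i`. [folklore] -/
theorem idxPre_spec {m : ℕ → ℕ} {Lay : FillLayout} {qs : List (List ℕ)} {i : ℕ} (hi : i < Lay.Ntot)
    (hS : FillSide w m Lay) {st : Store} (h : IdxInv m Lay qs i st) :
    ∃ st', Exec w O (block idxPre) st st' 4 ∧ DGInv st'.mem Lay.pt Lay.C Lay.r i qs 0 st' ∧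
      (∀ c, ¬ (84 ≤ c ∧ c ≤ 88) → st'.mem c = st.mem c) := by
  have hpt := hS.hpt; have hptE := hS.hptE; have hNtot := hS.hNtot; have hC := hS.hC
  have hrC : Lay.r ≤ Lay.r * Lay.C := Nat.le_mul_of_pos_right _ hC
  obtain ⟨hq, h33, h35, h36, h38, h39, h40, h41, h80, h82, h83, h92, h93, h94, hwr, hfr⟩ := h
  obtain ⟨mm, qq⟩ := st
  simp only at hq h33 h35 h36 h38 h39 h40 h41 h80 h82 h83 h92 h93 h94 hwr hfr ⊢
  subst qq
  refine Exec.block_of_fwd idxPre qs fun Rf hR => ?_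
  unfold idxPre at hR
  have htmp := execOps_cons_fwd hR; clear hR; obtain ⟨v1, hv1, hR⟩ := htmp
  simp -failIfUnchanged (disch := omega) only [Operand.write, Operand.read,
    Function.update_self, Function.update_of_ne, BinOp.eval_add_mod', BinOp.eval_mul_mod',
    Nat.mod_eq_of_lt, BinOp.eval_sub_of_le, BinOp.eval_mod, BinOp.eval_div, BinOp.eval_band,
    Nat.add_zero] at hv1 hR
  subst v1
  have htmp := execOps_cons_fwd hR; clear hR; obtain ⟨v2, hv2, hR⟩ := htmp
  simp -failIfUnchanged (disch := omega) only [Operand.write, Operand.read,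
    Function.update_self, Function.update_of_ne, BinOp.eval_add_mod', BinOp.eval_mul_mod',
    Nat.mod_eq_of_lt, BinOp.eval_sub_of_le, BinOp.eval_mod, BinOp.eval_div, BinOp.eval_band,
    Nat.add_zero, h83] at hv2 hR
  subst v2
  have htmp := execOps_cons_fwd hR; clear hR; obtain ⟨v3, hv3, hR⟩ := htmp
  simp -failIfUnchanged (disch := omega) only [Operand.write, Operand.read,
    Function.update_self, Function.update_of_ne, BinOp.eval_add_mod', BinOp.eval_mul_mod',
    Nat.mod_eq_of_lt, BinOp.eval_sub_of_le, BinOp.eval_mod, BinOp.eval_div, BinOp.eval_band,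
    Nat.add_zero, h33] at hv3 hR
  subst v3
  have htmp := execOps_cons_fwd hR; clear hR; obtain ⟨v4, hv4, hR⟩ := htmp
  simp -failIfUnchanged (disch := omega) only [Operand.write, Operand.read,
    Function.update_self, Function.update_of_ne, BinOp.eval_add_mod', BinOp.eval_mul_mod',
    Nat.mod_eq_of_lt, BinOp.eval_sub_of_le, BinOp.eval_mod, BinOp.eval_div, BinOp.eval_band,
    Nat.add_zero, h36] at hv4 hR
  subst v4
  simp only [execOps_nil] at hR
  subst hR
  refine ⟨⟨rfl, ?_, ?_, ?_, ?_, ?_, fun c _ _ _ _ _ => rfl⟩, fun c hc => ?_⟩ <;> dsimp only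
  · simp (disch := omega) only [Function.update_of_ne, Function.update_self]; exact h35
  · simp (disch := omega) only [Function.update_of_ne, Function.update_self]; simp [maskSum]
  · simp (disch := omega) only [Function.update_of_ne, Function.update_self]; simp
  · simp (disch := omega) only [Function.update_of_ne, Function.update_self]; omega
  · simp (disch := omega) only [Function.update_of_ne, Function.update_self]; omega
  · simp (disch := omega) only [Function.update_of_ne, Function.update_self]

set_option maxHeartbeats 1600000 in
set_option linter.unusedSimpArgs false in
/-- `idxPost`: the three legs of index `i`, then advance. [cite: Pratt2024SCC, §2 (proof of Thm. 1.9)] -/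
theorem idxPost_spec {m : ℕ → ℕ} {Lay : FillLayout} {qs : List (List ℕ)} {i : ℕ} (hi : i < Lay.Ntot)
    (hS : FillSide w m Lay) {st st₁ st₂ : Store} (h : IdxInv m Lay qs i st)
    (h₁ : ∀ c, ¬ (84 ≤ c ∧ c ≤ 88) → st₁.mem c = st.mem c)
    (h₂ : DGInv st₁.mem Lay.pt Lay.C Lay.r i qs Lay.r st₂) :
    ∃ st', Exec w O (block idxPost) st₂ st' 26 ∧ IdxInv m Lay qs (i + 1) st' := by
  have hpt := hS.hpt; have hC := hS.hC; have hptE := hS.hptE; have hNtot := hS.hNtot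
  have hcp := hS.hcp; have hcpE := hS.hcpE; have hw := hS.hw
  have hrC : Lay.r ≤ Lay.r * Lay.C := Nat.le_mul_of_pos_right _ hC
  have hFT0 := hS.hFT 0 (by norm_num); have hFT1 := hS.hFT 1 (by norm_num); have hFT2 := hS.hFT 2 (by norm_num)
  have hX0 := hS.hX 0 (by norm_num); have hX1 := hS.hX 1 (by norm_num); have hX2 := hS.hX 2 (by norm_num)
  have hM := hS.hmask i hi
  have hw16 : 16 ≤ 2 ^ w := by
    calc (16 : ℕ) = 2 ^ 4 := by norm_num
      _ ≤ 2 ^ w := Nat.pow_le_pow_right (by norm_num) hw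
  -- plain distinctness facts (no disjunctions are kept in the context: `omega` splits on them)
  have hne1 : Lay.X 0 + i ≠ Lay.cp₀ + 3 * i + 1 := by
    rcases hS.hX_cp 0 (by norm_num) with hh | hh <;> omega
  have hne2 : Lay.X 0 + i ≠ Lay.cp₀ + 3 * i + 1 + 1 := by
    rcases hS.hX_cp 0 (by norm_num) with hh | hh <;> omega
  have hne3 : Lay.X 1 + i ≠ Lay.cp₀ + 3 * i + 1 + 1 := by
    rcases hS.hX_cp 1 (by norm_num) with hh | hh <;> omega
  have hne4 : Lay.X 0 + i ≠ Lay.FT 1 + maskSum m Lay.pt Lay.C i Lay.r := by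
    rcases hS.hX_FT 0 1 (by norm_num) (by norm_num) with hh | hh <;> omega
  have hne5 : Lay.X 0 + i ≠ Lay.FT 2 + maskSum m Lay.pt Lay.C i Lay.r := by
    rcases hS.hX_FT 0 2 (by norm_num) (by norm_num) with hh | hh <;> omega
  have hne6 : Lay.X 1 + i ≠ Lay.FT 2 + maskSum m Lay.pt Lay.C i Lay.r := by
    rcases hS.hX_FT 1 2 (by norm_num) (by norm_num) with hh | hh <;> omega
  have hne7 : Lay.X 0 + i ≠ Lay.X 1 + i := by
    rcases hS.hX_X 0 1 (by norm_num) (by norm_num) (by norm_num) with hh | hh <;> omega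
  have hne8 : Lay.X 0 + i ≠ Lay.X 2 + i := by
    rcases hS.hX_X 0 2 (by norm_num) (by norm_num) (by norm_num) with hh | hh <;> omega
  have hne9 : Lay.X 1 + i ≠ Lay.X 2 + i := by
    rcases hS.hX_X 1 2 (by norm_num) (by norm_num) (by norm_num) with hh | hh <;> omega
  obtain ⟨hq₂, g35, g84, g85, g86, g87, gfr⟩ := h₂
  obtain ⟨mm, qq⟩ := st₂
  simp only at hq₂ g35 g84 g85 g86 g87 gfr
  subst qq
  -- reading through the three frames
  have hrd : ∀ c, 100 ≤ c → ¬ (Lay.X 0 ≤ c ∧ c < Lay.X 0 + i) → ¬ (Lay.X 1 ≤ c ∧ c < Lay.X 1 + i) →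
      ¬ (Lay.X 2 ≤ c ∧ c < Lay.X 2 + i) → mm c = m c := by
    intro c hc h0 h1' h2'
    rw [gfr c (by omega) (by omega) (by omega) (by omega) (by omega), h₁ c (by omega)]
    exact h.frame c (by omega) (by omega) h0 h1' h2'
  -- the mask register holds the mask of the reference memory
  have hMeq : maskSum st₁.mem Lay.pt Lay.C i Lay.r = maskSum m Lay.pt Lay.C i Lay.r := by
    unfold maskSum
    refine sum_congr rfl fun u hu => ?_
    rw [mem_range] at hu
    have hdg : digit Lay.C u i < Lay.C := digit_lt (by omega) _ _
    have huC : u * Lay.C + Lay.C ≤ Lay.r * Lay.C := by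
      have := Nat.mul_le_mul_right Lay.C hu; rw [Nat.succ_mul] at this; exact this
    rw [h₁ _ (by omega)]
    exact h.frame _ (by omega) (by omega)
      (by rcases hS.hX_pt 0 (by norm_num) with hh | hh <;> omega)
      (by rcases hS.hX_pt 1 (by norm_num) with hh | hh <;> omega)
      (by rcases hS.hX_pt 2 (by norm_num) with hh | hh <;> omega)
  rw [hMeq] at g84
  -- register values of `st₂`
  have h80 : mm 80 = Lay.cp₀ + 3 * i := by
    rw [gfr 80 (by omega) (by omega) (by omega) (by omega) (by omega), h₁ 80 (by omega)]; exact h.r80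
  have h82 : mm 82 = Lay.Ntot - i := by
    rw [gfr 82 (by omega) (by omega) (by omega) (by omega) (by omega), h₁ 82 (by omega)]; exact h.r82
  have h83 : mm 83 = i := by
    rw [gfr 83 (by omega) (by omega) (by omega) (by omega) (by omega), h₁ 83 (by omega)]; exact h.r83
  have h39 : mm 39 = Lay.FT 0 := by
    rw [gfr 39 (by omega) (by omega) (by omega) (by omega) (by omega), h₁ 39 (by omega)]; exact h.r39
  have h40 : mm 40 = Lay.FT 1 := by
    rw [gfr 40 (by omega) (by omega) (by omega) (by omega) (by omega), h₁ 40 (by omega)]; exact h.r40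
  have h41 : mm 41 = Lay.FT 2 := by
    rw [gfr 41 (by omega) (by omega) (by omega) (by omega) (by omega), h₁ 41 (by omega)]; exact h.r41
  have h92 : mm 92 = Lay.X 0 + i := by
    rw [gfr 92 (by omega) (by omega) (by omega) (by omega) (by omega), h₁ 92 (by omega)]; exact h.r92
  have h93 : mm 93 = Lay.X 1 + i := by
    rw [gfr 93 (by omega) (by omega) (by omega) (by omega) (by omega), h₁ 93 (by omega)]; exact h.r93
  have h94 : mm 94 = Lay.X 2 + i := by
    rw [gfr 94 (by omega) (by omega) (by omega) (by omega) (by omega), h₁ 94 (by omega)]; exact h.r94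
  -- the six data reads
  have hc0 : mm (Lay.cp₀ + 3 * i) = m (Lay.cp₀ + 3 * i) := hrd _ (by omega)
    (by rcases hS.hX_cp 0 (by norm_num) with hh | hh <;> omega)
    (by rcases hS.hX_cp 1 (by norm_num) with hh | hh <;> omega)
    (by rcases hS.hX_cp 2 (by norm_num) with hh | hh <;> omega)
  have hc1 : mm (Lay.cp₀ + 3 * i + 1) = m (Lay.cp₀ + 3 * i + 1) := hrd _ (by omega)
    (by rcases hS.hX_cp 0 (by norm_num) with hh | hh <;> omega)
    (by rcases hS.hX_cp 1 (by norm_num) with hh | hh <;> omega)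
    (by rcases hS.hX_cp 2 (by norm_num) with hh | hh <;> omega)
  have hc2 : mm (Lay.cp₀ + 3 * i + 1 + 1) = m (Lay.cp₀ + 3 * i + 1 + 1) := hrd _ (by omega)
    (by rcases hS.hX_cp 0 (by norm_num) with hh | hh <;> omega)
    (by rcases hS.hX_cp 1 (by norm_num) with hh | hh <;> omega)
    (by rcases hS.hX_cp 2 (by norm_num) with hh | hh <;> omega)
  have hcv0 : m (Lay.cp₀ + 3 * i) < 2 ^ w := hS.hcoin (3 * i) (by omega)
  have hcv1 : m (Lay.cp₀ + 3 * i + 1) < 2 ^ w := by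
    rw [Nat.add_assoc]; exact hS.hcoin (3 * i + 1) (by omega)
  have hcv2 : m (Lay.cp₀ + 3 * i + 1 + 1) < 2 ^ w := by
    rw [Nat.add_assoc, Nat.add_assoc]; exact hS.hcoin (3 * i + (1 + 1)) (by omega)
  have hf0 : mm (Lay.FT 0 + maskSum m Lay.pt Lay.C i Lay.r) = m (Lay.FT 0 + maskSum m Lay.pt Lay.C i Lay.r) :=
    hrd _ (by omega) (by rcases hS.hX_FT 0 0 (by norm_num) (by norm_num) with hh | hh <;> omega)
      (by rcases hS.hX_FT 1 0 (by norm_num) (by norm_num) with hh | hh <;> omega)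
      (by rcases hS.hX_FT 2 0 (by norm_num) (by norm_num) with hh | hh <;> omega)
  have hf1 : mm (Lay.FT 1 + maskSum m Lay.pt Lay.C i Lay.r) = m (Lay.FT 1 + maskSum m Lay.pt Lay.C i Lay.r) :=
    hrd _ (by omega) (by rcases hS.hX_FT 0 1 (by norm_num) (by norm_num) with hh | hh <;> omega)
      (by rcases hS.hX_FT 1 1 (by norm_num) (by norm_num) with hh | hh <;> omega)
      (by rcases hS.hX_FT 2 1 (by norm_num) (by norm_num) with hh | hh <;> omega)
  have hf2 : mm (Lay.FT 2 + maskSum m Lay.pt Lay.C i Lay.r) = m (Lay.FT 2 + maskSum m Lay.pt Lay.C i Lay.r) :=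
    hrd _ (by omega) (by rcases hS.hX_FT 0 2 (by norm_num) (by norm_num) with hh | hh <;> omega)
      (by rcases hS.hX_FT 1 2 (by norm_num) (by norm_num) with hh | hh <;> omega)
      (by rcases hS.hX_FT 2 2 (by norm_num) (by norm_num) with hh | hh <;> omega)
  have hb0 : m (Lay.FT 0 + maskSum m Lay.pt Lay.C i Lay.r) ≤ 1 := hS.hbit 0 _ (by norm_num) hM
  have hb1 : m (Lay.FT 1 + maskSum m Lay.pt Lay.C i Lay.r) ≤ 1 := hS.hbit 1 _ (by norm_num) hM
  have hb2 : m (Lay.FT 2 + maskSum m Lay.pt Lay.C i Lay.r) ≤ 1 := hS.hbit 2 _ (by norm_num) hM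
  have hm16a : m (Lay.cp₀ + 3 * i) % 16 < 16 := Nat.mod_lt _ (by norm_num)
  have hm16b : m (Lay.cp₀ + 3 * i + 1) % 16 < 16 := Nat.mod_lt _ (by norm_num)
  have hm16c : m (Lay.cp₀ + 3 * i + 1 + 1) % 16 < 16 := Nat.mod_lt _ (by norm_num)
  refine Exec.block_of_fwd idxPost qs fun Rf hR => ?_
  unfold idxPost legOps at hR
  simp only [List.cons_append, List.nil_append, Nat.add_zero, show (39 : ℕ) + 1 = 40 by rfl,
    show (39 : ℕ) + 2 = 41 by rfl, show (92 : ℕ) + 1 = 93 by rfl, show (92 : ℕ) + 2 = 94 by rfl] at hR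
  have htmp := execOps_cons_fwd hR; clear hR; obtain ⟨v1, hv1, hR⟩ := htmp
  simp -failIfUnchanged (disch := omega) only [Operand.write, Operand.read,
    Function.update_self, Function.update_of_ne, BinOp.eval_add_mod', BinOp.eval_mul_mod',
    Nat.mod_eq_of_lt, BinOp.eval_sub_of_le, BinOp.eval_mod, BinOp.eval_div, BinOp.eval_band,
    Nat.add_zero, h80, hc0] at hv1 hR
  subst v1
  have htmp := execOps_cons_fwd hR; clear hR; obtain ⟨v2, hv2, hR⟩ := htmp
  simp -failIfUnchanged (disch := omega) only [Operand.write, Operand.read,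
    Function.update_self, Function.update_of_ne, BinOp.eval_add_mod', BinOp.eval_mul_mod',
    Nat.mod_eq_of_lt, BinOp.eval_sub_of_le, BinOp.eval_mod, BinOp.eval_div, BinOp.eval_band,
    Nat.add_zero, h80] at hv2 hR
  subst v2
  have htmp := execOps_cons_fwd hR; clear hR; obtain ⟨v3, hv3, hR⟩ := htmp
  simp -failIfUnchanged (disch := omega) only [Operand.write, Operand.read,
    Function.update_self, Function.update_of_ne, BinOp.eval_add_mod', BinOp.eval_mul_mod',
    Nat.mod_eq_of_lt, BinOp.eval_sub_of_le, BinOp.eval_mod, BinOp.eval_div, BinOp.eval_band,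
    Nat.add_zero, Nat.and_fifteen] at hv3 hR
  subst v3
  have htmp := execOps_cons_fwd hR; clear hR; obtain ⟨v4, hv4, hR⟩ := htmp
  simp -failIfUnchanged (disch := omega) only [Operand.write, Operand.read,
    Function.update_self, Function.update_of_ne, BinOp.eval_add_mod', BinOp.eval_mul_mod',
    Nat.mod_eq_of_lt, BinOp.eval_sub_of_le, BinOp.eval_mod, BinOp.eval_div, BinOp.eval_band,
    Nat.add_zero, h39, g84] at hv4 hR
  subst v4
  have htmp := execOps_cons_fwd hR; clear hR; obtain ⟨v5, hv5, hR⟩ := htmp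
  simp -failIfUnchanged (disch := omega) only [Operand.write, Operand.read,
    Function.update_self, Function.update_of_ne, BinOp.eval_add_mod', BinOp.eval_mul_mod',
    Nat.mod_eq_of_lt, BinOp.eval_sub_of_le, BinOp.eval_mod, BinOp.eval_div, BinOp.eval_band,
    Nat.add_zero, hf0] at hv5 hR
  subst v5
  have htmp := execOps_cons_fwd hR; clear hR; obtain ⟨v6, hv6, hR⟩ := htmp
  simp -failIfUnchanged (disch := omega) only [Operand.write, Operand.read,
    Function.update_self, Function.update_of_ne, BinOp.eval_add_mod', BinOp.eval_mul_mod',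
    Nat.mod_eq_of_lt, BinOp.eval_sub_of_le, BinOp.eval_mod, BinOp.eval_div, BinOp.eval_band,
    Nat.add_zero] at hv6 hR
  subst v6
  have htmp := execOps_cons_fwd hR; clear hR; obtain ⟨v7, hv7, hR⟩ := htmp
  simp -failIfUnchanged (disch := omega) only [Operand.write, Operand.read,
    Function.update_self, Function.update_of_ne, BinOp.eval_add_mod', BinOp.eval_mul_mod',
    Nat.mod_eq_of_lt, BinOp.eval_sub_of_le, BinOp.eval_mod, BinOp.eval_div, BinOp.eval_band,
    Nat.add_zero, h92] at hv7 hR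
  subst v7
  have htmp := execOps_cons_fwd hR; clear hR; obtain ⟨v8, hv8, hR⟩ := htmp
  simp -failIfUnchanged (disch := omega) only [Operand.write, Operand.read,
    Function.update_self, Function.update_of_ne, BinOp.eval_add_mod', BinOp.eval_mul_mod',
    Nat.mod_eq_of_lt, BinOp.eval_sub_of_le, BinOp.eval_mod, BinOp.eval_div, BinOp.eval_band,
    Nat.add_zero, h92] at hv8 hR
  subst v8
  have htmp := execOps_cons_fwd hR; clear hR; obtain ⟨v9, hv9, hR⟩ := htmp
  simp -failIfUnchanged (disch := omega) only [Operand.write, Operand.read,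
    Function.update_self, Function.update_of_ne, BinOp.eval_add_mod', BinOp.eval_mul_mod',
    Nat.mod_eq_of_lt, BinOp.eval_sub_of_le, BinOp.eval_mod, BinOp.eval_div, BinOp.eval_band,
    Nat.add_zero, h80, hc1] at hv9 hR
  subst v9
  have htmp := execOps_cons_fwd hR; clear hR; obtain ⟨v10, hv10, hR⟩ := htmp
  simp -failIfUnchanged (disch := omega) only [Operand.write, Operand.read,
    Function.update_self, Function.update_of_ne, BinOp.eval_add_mod', BinOp.eval_mul_mod',
    Nat.mod_eq_of_lt, BinOp.eval_sub_of_le, BinOp.eval_mod, BinOp.eval_div, BinOp.eval_band,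
    Nat.add_zero, h80] at hv10 hR
  subst v10
  have htmp := execOps_cons_fwd hR; clear hR; obtain ⟨v11, hv11, hR⟩ := htmp
  simp -failIfUnchanged (disch := omega) only [Operand.write, Operand.read,
    Function.update_self, Function.update_of_ne, BinOp.eval_add_mod', BinOp.eval_mul_mod',
    Nat.mod_eq_of_lt, BinOp.eval_sub_of_le, BinOp.eval_mod, BinOp.eval_div, BinOp.eval_band,
    Nat.add_zero, Nat.and_fifteen] at hv11 hR
  subst v11
  have htmp := execOps_cons_fwd hR; clear hR; obtain ⟨v12, hv12, hR⟩ := htmp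
  simp -failIfUnchanged (disch := omega) only [Operand.write, Operand.read,
    Function.update_self, Function.update_of_ne, BinOp.eval_add_mod', BinOp.eval_mul_mod',
    Nat.mod_eq_of_lt, BinOp.eval_sub_of_le, BinOp.eval_mod, BinOp.eval_div, BinOp.eval_band,
    Nat.add_zero, h40, g84] at hv12 hR
  subst v12
  have htmp := execOps_cons_fwd hR; clear hR; obtain ⟨v13, hv13, hR⟩ := htmp
  simp -failIfUnchanged (disch := omega) only [Operand.write, Operand.read,
    Function.update_self, Function.update_of_ne, BinOp.eval_add_mod', BinOp.eval_mul_mod',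
    Nat.mod_eq_of_lt, BinOp.eval_sub_of_le, BinOp.eval_mod, BinOp.eval_div, BinOp.eval_band,
    Nat.add_zero, hf1] at hv13 hR
  subst v13
  have htmp := execOps_cons_fwd hR; clear hR; obtain ⟨v14, hv14, hR⟩ := htmp
  simp -failIfUnchanged (disch := omega) only [Operand.write, Operand.read,
    Function.update_self, Function.update_of_ne, BinOp.eval_add_mod', BinOp.eval_mul_mod',
    Nat.mod_eq_of_lt, BinOp.eval_sub_of_le, BinOp.eval_mod, BinOp.eval_div, BinOp.eval_band,
    Nat.add_zero] at hv14 hR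
  subst v14
  have htmp := execOps_cons_fwd hR; clear hR; obtain ⟨v15, hv15, hR⟩ := htmp
  simp -failIfUnchanged (disch := omega) only [Operand.write, Operand.read,
    Function.update_self, Function.update_of_ne, BinOp.eval_add_mod', BinOp.eval_mul_mod',
    Nat.mod_eq_of_lt, BinOp.eval_sub_of_le, BinOp.eval_mod, BinOp.eval_div, BinOp.eval_band,
    Nat.add_zero, h93] at hv15 hR
  subst v15
  have htmp := execOps_cons_fwd hR; clear hR; obtain ⟨v16, hv16, hR⟩ := htmp
  simp -failIfUnchanged (disch := omega) only [Operand.write, Operand.read,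
    Function.update_self, Function.update_of_ne, BinOp.eval_add_mod', BinOp.eval_mul_mod',
    Nat.mod_eq_of_lt, BinOp.eval_sub_of_le, BinOp.eval_mod, BinOp.eval_div, BinOp.eval_band,
    Nat.add_zero, h93] at hv16 hR
  subst v16
  have htmp := execOps_cons_fwd hR; clear hR; obtain ⟨v17, hv17, hR⟩ := htmp
  simp -failIfUnchanged (disch := omega) only [Operand.write, Operand.read,
    Function.update_self, Function.update_of_ne, BinOp.eval_add_mod', BinOp.eval_mul_mod',
    Nat.mod_eq_of_lt, BinOp.eval_sub_of_le, BinOp.eval_mod, BinOp.eval_div, BinOp.eval_band,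
    Nat.add_zero, h80, hc2] at hv17 hR
  subst v17
  have htmp := execOps_cons_fwd hR; clear hR; obtain ⟨v18, hv18, hR⟩ := htmp
  simp -failIfUnchanged (disch := omega) only [Operand.write, Operand.read,
    Function.update_self, Function.update_of_ne, BinOp.eval_add_mod', BinOp.eval_mul_mod',
    Nat.mod_eq_of_lt, BinOp.eval_sub_of_le, BinOp.eval_mod, BinOp.eval_div, BinOp.eval_band,
    Nat.add_zero, h80] at hv18 hR
  subst v18
  have htmp := execOps_cons_fwd hR; clear hR; obtain ⟨v19, hv19, hR⟩ := htmp
  simp -failIfUnchanged (disch := omega) only [Operand.write, Operand.read,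
    Function.update_self, Function.update_of_ne, BinOp.eval_add_mod', BinOp.eval_mul_mod',
    Nat.mod_eq_of_lt, BinOp.eval_sub_of_le, BinOp.eval_mod, BinOp.eval_div, BinOp.eval_band,
    Nat.add_zero, Nat.and_fifteen] at hv19 hR
  subst v19
  have htmp := execOps_cons_fwd hR; clear hR; obtain ⟨v20, hv20, hR⟩ := htmp
  simp -failIfUnchanged (disch := omega) only [Operand.write, Operand.read,
    Function.update_self, Function.update_of_ne, BinOp.eval_add_mod', BinOp.eval_mul_mod',
    Nat.mod_eq_of_lt, BinOp.eval_sub_of_le, BinOp.eval_mod, BinOp.eval_div, BinOp.eval_band,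
    Nat.add_zero, h41, g84] at hv20 hR
  subst v20
  have htmp := execOps_cons_fwd hR; clear hR; obtain ⟨v21, hv21, hR⟩ := htmp
  simp -failIfUnchanged (disch := omega) only [Operand.write, Operand.read,
    Function.update_self, Function.update_of_ne, BinOp.eval_add_mod', BinOp.eval_mul_mod',
    Nat.mod_eq_of_lt, BinOp.eval_sub_of_le, BinOp.eval_mod, BinOp.eval_div, BinOp.eval_band,
    Nat.add_zero, hf2] at hv21 hR
  subst v21
  have htmp := execOps_cons_fwd hR; clear hR; obtain ⟨v22, hv22, hR⟩ := htmp
  simp -failIfUnchanged (disch := omega) only [Operand.write, Operand.read,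
    Function.update_self, Function.update_of_ne, BinOp.eval_add_mod', BinOp.eval_mul_mod',
    Nat.mod_eq_of_lt, BinOp.eval_sub_of_le, BinOp.eval_mod, BinOp.eval_div, BinOp.eval_band,
    Nat.add_zero] at hv22 hR
  subst v22
  have htmp := execOps_cons_fwd hR; clear hR; obtain ⟨v23, hv23, hR⟩ := htmp
  simp -failIfUnchanged (disch := omega) only [Operand.write, Operand.read,
    Function.update_self, Function.update_of_ne, BinOp.eval_add_mod', BinOp.eval_mul_mod',
    Nat.mod_eq_of_lt, BinOp.eval_sub_of_le, BinOp.eval_mod, BinOp.eval_div, BinOp.eval_band,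
    Nat.add_zero, h94] at hv23 hR
  subst v23
  have htmp := execOps_cons_fwd hR; clear hR; obtain ⟨v24, hv24, hR⟩ := htmp
  simp -failIfUnchanged (disch := omega) only [Operand.write, Operand.read,
    Function.update_self, Function.update_of_ne, BinOp.eval_add_mod', BinOp.eval_mul_mod',
    Nat.mod_eq_of_lt, BinOp.eval_sub_of_le, BinOp.eval_mod, BinOp.eval_div, BinOp.eval_band,
    Nat.add_zero, h94] at hv24 hR
  subst v24
  have htmp := execOps_cons_fwd hR; clear hR; obtain ⟨v25, hv25, hR⟩ := htmp
  simp -failIfUnchanged (disch := omega) only [Operand.write, Operand.read,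
    Function.update_self, Function.update_of_ne, BinOp.eval_add_mod', BinOp.eval_mul_mod',
    Nat.mod_eq_of_lt, BinOp.eval_sub_of_le, BinOp.eval_mod, BinOp.eval_div, BinOp.eval_band,
    Nat.add_zero, h83] at hv25 hR
  subst v25
  have htmp := execOps_cons_fwd hR; clear hR; obtain ⟨v26, hv26, hR⟩ := htmp
  simp -failIfUnchanged (disch := omega) only [Operand.write, Operand.read,
    Function.update_self, Function.update_of_ne, BinOp.eval_add_mod', BinOp.eval_mul_mod',
    Nat.mod_eq_of_lt, BinOp.eval_sub_of_le, BinOp.eval_mod, BinOp.eval_div, BinOp.eval_band,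
    Nat.add_zero, h82] at hv26 hR
  subst v26
  simp only [execOps_nil] at hR
  subst hR
  have hreg : ∀ c, c < 100 → ¬ (84 ≤ c ∧ c ≤ 88) → mm c = st.mem c := fun c hc hc' => by
    rw [gfr c (by omega) (by omega) (by omega) (by omega) (by omega), h₁ c hc']
  have hprod : ∀ {a b : ℕ}, a ≤ 1 → b < 16 → a * b % 2 ^ w = a * b := fun {a b} ha hb => by
    apply Nat.mod_eq_of_lt
    calc a * b ≤ 1 * b := Nat.mul_le_mul_right b ha
      _ < 2 ^ w := by omega
  refine ⟨rfl, ?_, ?_, ?_, ?_, ?_, ?_, ?_, ?_, ?_, ?_, ?_, ?_, ?_, fun l i' hl hi' => ?_,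
    fun c h80' hc h0' h1' h2' => ?_⟩ <;> dsimp only
  · simp (disch := omega) only [Function.update_of_ne, Function.update_self]; rw [hreg 33 (by omega) (by omega)]; exact h.r33
  · simp (disch := omega) only [Function.update_of_ne, Function.update_self]; exact g35
  · simp (disch := omega) only [Function.update_of_ne, Function.update_self]; rw [hreg 36 (by omega) (by omega)]; exact h.r36
  · simp (disch := omega) only [Function.update_of_ne, Function.update_self]; rw [hreg 38 (by omega) (by omega)]; exact h.r38
  · simp (disch := omega) only [Function.update_of_ne, Function.update_self]; exact h39
  · simp (disch := omega) only [Function.update_of_ne, Function.update_self]; exact h40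
  · simp (disch := omega) only [Function.update_of_ne, Function.update_self]; exact h41
  · simp (disch := omega) only [Function.update_of_ne, Function.update_self]; omega
  · simp (disch := omega) only [Function.update_of_ne, Function.update_self]; omega
  · simp (disch := omega) only [Function.update_of_ne, Function.update_self]
  · simp (disch := omega) only [Function.update_of_ne, Function.update_self]; omega
  · simp (disch := omega) only [Function.update_of_ne, Function.update_self]; omega
  · simp (disch := omega) only [Function.update_of_ne, Function.update_self]; omega
  · -- written
    obtain rfl | rfl | rfl : l = 0 ∨ l = 1 ∨ l = 2 := by omega
    · rcases Nat.lt_succ_iff_lt_or_eq.1 hi' with hlt | rfl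
      · have hn1 : Lay.X 0 + i' ≠ Lay.X 1 + i := by
          rcases hS.hX_X 0 1 (by norm_num) (by norm_num) (by norm_num) with hh | hh <;> omega
        have hn2 : Lay.X 0 + i' ≠ Lay.X 2 + i := by
          rcases hS.hX_X 0 2 (by norm_num) (by norm_num) (by norm_num) with hh | hh <;> omega
        simp (disch := omega) only [Function.update_of_ne, Function.update_self]
        rw [gfr _ (by omega) (by omega) (by omega) (by omega) (by omega), h₁ _ (by omega)]
        exact h.written 0 i' (by norm_num) hlt
      · simp (disch := omega) only [Function.update_of_ne, Function.update_self]
        rw [hprod hb0 hm16a]; simp [fillVal]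
    · rcases Nat.lt_succ_iff_lt_or_eq.1 hi' with hlt | rfl
      · have hn1 : Lay.X 1 + i' ≠ Lay.X 0 + i := by
          rcases hS.hX_X 1 0 (by norm_num) (by norm_num) (by norm_num) with hh | hh <;> omega
        have hn2 : Lay.X 1 + i' ≠ Lay.X 2 + i := by
          rcases hS.hX_X 1 2 (by norm_num) (by norm_num) (by norm_num) with hh | hh <;> omega
        simp (disch := omega) only [Function.update_of_ne, Function.update_self]
        rw [gfr _ (by omega) (by omega) (by omega) (by omega) (by omega), h₁ _ (by omega)]
        exact h.written 1 i' (by norm_num) hlt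
      · simp (disch := omega) only [Function.update_of_ne, Function.update_self]
        rw [hprod hb1 hm16b]; simp [fillVal]
    · rcases Nat.lt_succ_iff_lt_or_eq.1 hi' with hlt | rfl
      · have hn1 : Lay.X 2 + i' ≠ Lay.X 0 + i := by
          rcases hS.hX_X 2 0 (by norm_num) (by norm_num) (by norm_num) with hh | hh <;> omega
        have hn2 : Lay.X 2 + i' ≠ Lay.X 1 + i := by
          rcases hS.hX_X 2 1 (by norm_num) (by norm_num) (by norm_num) with hh | hh <;> omega
        simp (disch := omega) only [Function.update_of_ne, Function.update_self]
        rw [gfr _ (by omega) (by omega) (by omega) (by omega) (by omega), h₁ _ (by omega)]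
        exact h.written 2 i' (by norm_num) hlt
      · simp (disch := omega) only [Function.update_of_ne, Function.update_self]
        rw [hprod hb2 hm16c]
        simp only [fillVal, Nat.add_assoc, Nat.reduceAdd]
  · -- frame
    simp (disch := omega) only [Function.update_of_ne, Function.update_self]
    by_cases hc100 : c < 100
    · rw [hreg c hc100 (by omega)]; exact h.frame c h80' hc (by omega) (by omega) (by omega)
    · exact hrd c (by omega) (by omega) (by omega) (by omega)

/-- One index: `4 + (8 r + 1) + 26` steps. [folklore] -/
theorem idxBody_spec {m : ℕ → ℕ} {Lay : FillLayout} {qs : List (List ℕ)} {i : ℕ} (hi : i < Lay.Ntot)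
    (hS : FillSide w m Lay) {st : Store} (h : IdxInv m Lay qs i st) :
    ∃ st', ExecLE w O idxBody st st' (Lay.r * 8 + 31) ∧ IdxInv m Lay qs (i + 1) st' := by
  obtain ⟨st₁, hex₁, hD, gfr⟩ := idxPre_spec (w := w) (O := O) hi hS h
  have hpt := hS.hpt; have hC := hS.hC; have hptE := hS.hptE
  have hFT0 := hS.hFT 0 (by norm_num)
  have hrC : Lay.r ≤ Lay.r * Lay.C := Nat.le_mul_of_pos_right _ hC
  have hMeq : maskSum st₁.mem Lay.pt Lay.C i Lay.r = maskSum m Lay.pt Lay.C i Lay.r := by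
    unfold maskSum
    refine sum_congr rfl fun u hu => ?_
    rw [mem_range] at hu
    have hdg : digit Lay.C u i < Lay.C := digit_lt (by omega) _ _
    have huC : u * Lay.C + Lay.C ≤ Lay.r * Lay.C := by
      have := Nat.mul_le_mul_right Lay.C hu; rw [Nat.succ_mul] at this; exact this
    rw [gfr _ (by omega)]
    exact h.frame _ (by omega) (by omega)
      (by rcases hS.hX_pt 0 (by norm_num) with hh | hh <;> omega)
      (by rcases hS.hX_pt 1 (by norm_num) with hh | hh <;> omega)
      (by rcases hS.hX_pt 2 (by norm_num) with hh | hh <;> omega)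
  have hmask : maskSum st₁.mem Lay.pt Lay.C i Lay.r < 2 ^ w := by
    rw [hMeq]; have := hS.hmask i hi; omega
  obtain ⟨st₂, hex₂, hD₂⟩ := digLoop_spec (w := w) (O := O) hpt hC hptE hmask hD
  obtain ⟨st₃, hex₃, hI⟩ := idxPost_spec (w := w) (O := O) hi hS h gfr hD₂
  exact ⟨st₃, ((hex₁.execLE).seq (hex₂.seq hex₃.execLE)).mono (by omega), hI⟩

set_option linter.unusedSimpArgs false in
/-- **The fill program.** With the layout registers set (`33 = pt`, `35 = C`, `36 = r`, `38 = Ntot`,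
`39–41 = FT`, `42–44 = X`, `80 = cp₀`) and the side conditions `FillSide`, `fillProg` ends within
`Ntot (8 r + 33) + 6` steps having written, for every leg `l < 3` and index `i < Ntot`,
`X_l[i] = Ftab_l[mask(i)] · (coin(3i+l) mod 16)` (`fillVal`), the coin pointer advanced to
`cp₀ + 3 Ntot`, and nothing else changed outside `80`, `82–94` and the three destinations.
[cite: Pratt2024SCC, §2 (proof of Thm. 1.9)] -/
theorem fillProg_spec {m : ℕ → ℕ} {Lay : FillLayout} (hS : FillSide w m Lay) (h33 : m 33 = Lay.pt)
    (h35 : m 35 = Lay.C) (h36 : m 36 = Lay.r) (h38 : m 38 = Lay.Ntot) (h39 : m 39 = Lay.FT 0)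
    (h40 : m 40 = Lay.FT 1) (h41 : m 41 = Lay.FT 2) (h42 : m 42 = Lay.X 0) (h43 : m 43 = Lay.X 1)
    (h44 : m 44 = Lay.X 2) (h80 : m 80 = Lay.cp₀) (qs : List (List ℕ)) :
    ∃ st', ExecLE w O fillProg ⟨m, qs⟩ st' (Lay.Ntot * (Lay.r * 8 + 33) + 6) ∧
      IdxInv m Lay qs Lay.Ntot st' := by
  have hNtot := hS.hNtot
  have hX0 := hS.hX 0 (by norm_num); have hX1 := hS.hX 1 (by norm_num); have hX2 := hS.hX 2 (by norm_num)
  obtain ⟨st₁, hex₁, hI⟩ : ∃ st', Exec w O (block fillSetup) ⟨m, qs⟩ st' 5 ∧ IdxInv m Lay qs 0 st' := by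
    refine Exec.block_of_fwd fillSetup qs fun Rf hR => ?_
    unfold fillSetup at hR
    have htmp := execOps_cons_fwd hR; clear hR; obtain ⟨v1, hv1, hR⟩ := htmp
    simp -failIfUnchanged (disch := omega) only [Operand.write, Operand.read,
      Function.update_self, Function.update_of_ne, BinOp.eval_add_mod', BinOp.eval_mul_mod',
      Nat.mod_eq_of_lt, BinOp.eval_sub_of_le, BinOp.eval_mod, BinOp.eval_div, BinOp.eval_band,
      Nat.add_zero, h38] at hv1 hR
    subst v1
    have htmp := execOps_cons_fwd hR; clear hR; obtain ⟨v2, hv2, hR⟩ := htmp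
    simp -failIfUnchanged (disch := omega) only [Operand.write, Operand.read,
      Function.update_self, Function.update_of_ne, BinOp.eval_add_mod', BinOp.eval_mul_mod',
      Nat.mod_eq_of_lt, BinOp.eval_sub_of_le, BinOp.eval_mod, BinOp.eval_div, BinOp.eval_band,
      Nat.add_zero] at hv2 hR
    subst v2
    have htmp := execOps_cons_fwd hR; clear hR; obtain ⟨v3, hv3, hR⟩ := htmp
    simp -failIfUnchanged (disch := omega) only [Operand.write, Operand.read,
      Function.update_self, Function.update_of_ne, BinOp.eval_add_mod', BinOp.eval_mul_mod',
      Nat.mod_eq_of_lt, BinOp.eval_sub_of_le, BinOp.eval_mod, BinOp.eval_div, BinOp.eval_band,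
      Nat.add_zero, h42] at hv3 hR
    subst v3
    have htmp := execOps_cons_fwd hR; clear hR; obtain ⟨v4, hv4, hR⟩ := htmp
    simp -failIfUnchanged (disch := omega) only [Operand.write, Operand.read,
      Function.update_self, Function.update_of_ne, BinOp.eval_add_mod', BinOp.eval_mul_mod',
      Nat.mod_eq_of_lt, BinOp.eval_sub_of_le, BinOp.eval_mod, BinOp.eval_div, BinOp.eval_band,
      Nat.add_zero, h43] at hv4 hR
    subst v4
    have htmp := execOps_cons_fwd hR; clear hR; obtain ⟨v5, hv5, hR⟩ := htmp
    simp -failIfUnchanged (disch := omega) only [Operand.write, Operand.read,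
      Function.update_self, Function.update_of_ne, BinOp.eval_add_mod', BinOp.eval_mul_mod',
      Nat.mod_eq_of_lt, BinOp.eval_sub_of_le, BinOp.eval_mod, BinOp.eval_div, BinOp.eval_band,
      Nat.add_zero, h44] at hv5 hR
    subst v5
    simp only [execOps_nil] at hR
    subst hR
    refine ⟨rfl, ?_, ?_, ?_, ?_, ?_, ?_, ?_, ?_, ?_, ?_, ?_, ?_, ?_,
      fun l i' _ hi' => (Nat.not_lt_zero _ hi').elim, fun c h80' hc _ _ _ => ?_⟩ <;> dsimp only
    · simp (disch := omega) only [Function.update_of_ne, Function.update_self]; exact h33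
    · simp (disch := omega) only [Function.update_of_ne, Function.update_self]; exact h35
    · simp (disch := omega) only [Function.update_of_ne, Function.update_self]; exact h36
    · simp (disch := omega) only [Function.update_of_ne, Function.update_self]; exact h38
    · simp (disch := omega) only [Function.update_of_ne, Function.update_self]; exact h39
    · simp (disch := omega) only [Function.update_of_ne, Function.update_self]; exact h40
    · simp (disch := omega) only [Function.update_of_ne, Function.update_self]; exact h41
    · simp (disch := omega) only [Function.update_of_ne, Function.update_self]; omega
    · simp (disch := omega) only [Function.update_of_ne, Function.update_self]; omega
    · simp (disch := omega) only [Function.update_of_ne, Function.update_self]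
    · simp (disch := omega) only [Function.update_of_ne, Function.update_self]; omega
    · simp (disch := omega) only [Function.update_of_ne, Function.update_self]; omega
    · simp (disch := omega) only [Function.update_of_ne, Function.update_self]; omega
    · simp (disch := omega) only [Function.update_of_ne, Function.update_self]
  obtain ⟨st', hex, hinv⟩ := ExecLE.whilenz_invariant (w := w) (O := O) (x := .dir 82) (s := idxBody)
    Lay.Ntot (Lay.r * 8 + 31) (fun i st => IdxInv m Lay qs i st)
    (fun i hi st hst => ⟨by rw [Operand.read_dir, hst.r82]; omega, idxBody_spec hi hS hst⟩)
    (fun st hst => by rw [Operand.read_dir, hst.r82]; omega) hI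
  rw [show Lay.r * 8 + 31 + 2 = Lay.r * 8 + 33 by omega] at hex
  exact ⟨st', (ExecLE.seq hex₁.execLE hex).mono (by omega), hinv⟩

end SProg

end Literature.Computability.Cryptography.WordRAM
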